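import Summits.ABC.ABC.Theses.IneffectiveSubspace
import Summits.ABC.ABC.Theorems.IneffectiveSubspaceCanonicalTowerLift
import Summits.ABC.ABC.Theorems.IneffectiveSubspaceTowerExponentWindowPolyAbcOfFlatBound
import Summits.ABC.ABC.Theorems.IneffectiveSubspaceUniformSadicTowerFourStubUniformInKIffAbc

/-!
# Stub `stub_placesToLevel` of line `Sketch` (card `mixed-radical-exchange-map`) — crux `IneffectiveSubspace.UniformSadicTowerFour` (stmt-ABC-14937)

PLACES → LEVEL. Vojta's inequality with exponent `1` at ONE level `N` — every positive coprime
level-`N` tower point `x, y, z : Fin N → ℕ` (`a = ∏ xᵢ^(i+1)`, `b`, `c` likewise, `a + b = c`,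
`gcd(a, b) = 1`) has `c < C(ε) · (∏ xᵢyᵢzᵢ)^(1+ε)` — gives, whenever `3(1+ε) < N`, the
MIXED-RADICAL inequality for EVERY finite set of primes `S`, with a constant free of `S`:
`c < C' · M_S(abc)^κ` for every abc triple `(a, b, c)`, where
`M_S(m) = (∏_{p ∈ S} p) · ∏_{p ∣ m, p ∉ S} p^⌈v_p(m)/4⌉` (`⌈v/4⌉ = (v + 3) / 4`),
`κ = (1+ε)N / (N − 3(1+ε))` and `C' = C^(N / (N − 3(1+ε)))`.  So the `S`-dial adds nothing beyond
the level dial.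

Proof. For an abc triple `(a, b, c)` take Vojta's canonical lifts `x` of `a`, `y` of `b`, `z` of `c`
at level `N` (`canonicalTowerLift_proof`: `∏ xᵢ^(i+1) = a`, `(∏ xᵢ)^N ≤ rad(a)^N · a`).  The
hypothesis at the lifted point reads `c < C · P^(1+ε)` with `P = ∏ xᵢyᵢzᵢ = (∏ xᵢ)(∏ yᵢ)(∏ zᵢ)`,
and in `ℕ`
`P^N ≤ (rad a · rad b · rad c)^N · abc = rad(abc)^N · abc ≤ M_S(abc)^N · c³`,
because `a, b ≤ c` and `rad(abc) = ∏_{p ∣ abc} p` divides `M_S(abc)` (inside `S` it divides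
`∏_{p ∈ S} p`, off `S` each `p ∣ abc` divides `p^⌈v_p(abc)/4⌉` as `v_p(abc) ≥ 1`), which is
positive when `S` consists of primes — this is `uniformInK_rad_le_mixed` / `uniformInK_mixed_pos`
of the sibling stub file `…StubUniformInKIffAbc`, reused rather than restated.  Taking logarithms,
`log c < log C + (1+ε) log P` and `N log P ≤ N log M_S + 3 log c`, so
`(N − 3(1+ε)) log c < N log C + (1+ε) N log M_S`; divide by `N − 3(1+ε) > 0` and exponentiate.

Sources: card mixed-radical-exchange-map (crux stmt-ABC-14937, line Sketch); Vojta 2000 §3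
(canonical lifts §3.1, proof of Thm 3.12) [Vojta2000ABC].  No new definitions; the main theorem
`stub_placesToLevel` is verbatim the registered stub of the skeleton
`Summits/ABC/ABC/Cruxes/UniformSadicTowerFour/Lines/Sketch.lean`; helpers are prefixed
`placesToLevel_`.  Deliberately NOT here: the other stubs of the line.
-/

-- `Summit.<Summit>.<Problem>` is the mandated summit-side namespace (CONVENTIONS §2); for the
-- single-conjunct summit `ABC` the two coincide, so the duplicate `ABC.ABC` is deliberate.
set_option linter.dupNamespace false

namespace Summit.ABC.ABC.Theorems.UniformSadicTowerFour.MixedRadical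

open Literature.NumberTheory.DiophantineGeometry (IsABCTriple rad rad_def)
open Summit.ABC.ABC.Theses.IneffectiveSubspace
open UniqueFactorizationMonoid (radical)
open scoped BigOperators

/-! ## The lifted point: `(∏ xᵢyᵢzᵢ)^N ≤ rad(abc)^N · c³` -/

/-- **Size of a canonically lifted abc triple** (Vojta 2000, proof of Thm 3.12). If `(a, b, c)` is
an abc triple and `x, y, z : Fin N → ℕ` satisfy the canonical-lift bounds
`(∏ xᵢ)^N ≤ rad(a)^N · a`, `(∏ yᵢ)^N ≤ rad(b)^N · b`, `(∏ zᵢ)^N ≤ rad(c)^N · c`, then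
`(∏ xᵢyᵢzᵢ)^N ≤ rad(abc)^N · c³`: multiply, use `rad a · rad b · rad c = rad(abc)` (pairwise
coprimality) and `abc ≤ c³`. [cite: Vojta2000ABC, §3] -/
theorem placesToLevel_lift_bound {N a b c : ℕ} (habc : IsABCTriple a b c) {x y z : Fin N → ℕ}
    (hx : (∏ i, x i) ^ N ≤ radical a ^ N * a) (hy : (∏ i, y i) ^ N ≤ radical b ^ N * b)
    (hz : (∏ i, z i) ^ N ≤ radical c ^ N * c) :
    (∏ i, x i * y i * z i) ^ N ≤ rad a b c ^ N * c ^ 3 := by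
  have hsum := habc.2.2.1
  have hale : a ≤ c := by omega
  have hble : b ≤ c := by omega
  rw [Finset.prod_mul_distrib, Finset.prod_mul_distrib, mul_pow, mul_pow,
    ← PolyAbcOfFlatBound.radical_mul_three_of_triple habc]
  calc (∏ i, x i) ^ N * (∏ i, y i) ^ N * (∏ i, z i) ^ N
      ≤ radical a ^ N * a * (radical b ^ N * b) * (radical c ^ N * c) :=
        Nat.mul_le_mul (Nat.mul_le_mul hx hy) hz
    _ = (radical a * radical b * radical c) ^ N * (a * b * c) := by ring
    _ ≤ (radical a * radical b * radical c) ^ N * (c * c * c) :=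
        Nat.mul_le_mul_left _ (Nat.mul_le_mul (Nat.mul_le_mul hale hble) le_rfl)
    _ = (radical a * radical b * radical c) ^ N * c ^ 3 := by ring

/-! ## The real rearrangement -/

/-- **Exponent bookkeeping.** If `c < C · P^(1+ε)` and `P^N ≤ M^N · c³` with `c, P, M ≥ 1`,
`C > 0` and `3(1+ε) < N`, then `c < C^(N/(N − 3(1+ε))) · M^((1+ε)N/(N − 3(1+ε)))`: in logarithms,
`log c < log C + (1+ε) log P` and `N log P ≤ N log M + 3 log c` give
`(N − 3(1+ε)) log c < N log C + (1+ε) N log M`. [folklore] -/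
theorem placesToLevel_exp_step {C ε : ℝ} {N : ℕ} (hC : 0 < C) (hε : 0 < ε)
    (hN : 3 * (1 + ε) < (N : ℝ)) {c P M : ℕ} (hc : 0 < c) (hP : 0 < P) (hM : 0 < M)
    (hmain : (c : ℝ) < C * (P : ℝ) ^ (1 + ε)) (hPN : P ^ N ≤ M ^ N * c ^ 3) :
    (c : ℝ) < C ^ ((N : ℝ) / (N - 3 * (1 + ε))) *
      (M : ℝ) ^ ((1 + ε) * N / (N - 3 * (1 + ε))) := by
  have hc0 : (0 : ℝ) < c := by exact_mod_cast hc
  have hP0 : (0 : ℝ) < P := by exact_mod_cast hP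
  have hM0 : (0 : ℝ) < M := by exact_mod_cast hM
  have hN0 : (0 : ℝ) < N := by linarith
  have he0 : (0 : ℝ) < 1 + ε := by linarith
  have hD : (0 : ℝ) < N - 3 * (1 + ε) := by linarith
  -- (1) the hypothesis at the lifted point, logarithmically
  have h1 : Real.log c < Real.log C + (1 + ε) * Real.log P := by
    have h := Real.log_lt_log hc0 hmain
    rwa [Real.log_mul hC.ne' (Real.rpow_pos_of_pos hP0 _).ne', Real.log_rpow hP0] at h
  -- (2) the lift bound, logarithmically
  have h2 : (N : ℝ) * Real.log P ≤ N * Real.log M + 3 * Real.log c := by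
    have hcast : (P : ℝ) ^ N ≤ (M : ℝ) ^ N * (c : ℝ) ^ 3 := by exact_mod_cast hPN
    have h := Real.log_le_log (pow_pos hP0 N) hcast
    rw [Real.log_mul (pow_pos hM0 N).ne' (pow_pos hc0 3).ne', Real.log_pow, Real.log_pow,
      Real.log_pow] at h
    exact_mod_cast h
  -- (3) eliminate `log P`
  have key : ((N : ℝ) - 3 * (1 + ε)) * Real.log c <
      N * Real.log C + (1 + ε) * N * Real.log M := by
    have h3 := mul_lt_mul_of_pos_left h1 hN0
    have h4 := mul_le_mul_of_nonneg_left h2 he0.le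
    nlinarith [h3, h4]
  have hlog : Real.log c < Real.log C * ((N : ℝ) / (N - 3 * (1 + ε))) +
      Real.log M * ((1 + ε) * N / (N - 3 * (1 + ε))) := by
    have hrw : Real.log C * ((N : ℝ) / (N - 3 * (1 + ε))) +
        Real.log M * ((1 + ε) * N / (N - 3 * (1 + ε))) =
        (N * Real.log C + (1 + ε) * N * Real.log M) / (N - 3 * (1 + ε)) := by ring
    rw [hrw, lt_div_iff₀ hD]
    linarith
  -- (4) exponentiate
  calc (c : ℝ) = Real.exp (Real.log c) := (Real.exp_log hc0).symm
    _ < Real.exp (Real.log C * ((N : ℝ) / (N - 3 * (1 + ε))) +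
        Real.log M * ((1 + ε) * N / (N - 3 * (1 + ε)))) := Real.exp_lt_exp.mpr hlog
    _ = C ^ ((N : ℝ) / (N - 3 * (1 + ε))) * (M : ℝ) ^ ((1 + ε) * N / (N - 3 * (1 + ε))) := by
        rw [Real.exp_add, Real.rpow_def_of_pos hC, Real.rpow_def_of_pos hM0]

/-! ## The stub -/

/-- **stub_placesToLevel (PLACES → LEVEL).** Vojta's inequality with exponent `1` at a single level `N`
(no finite places) gives the mixed inequality for EVERY finite set of primes `S`, constant free of `S`, at
exponent `(1+ε)N/(N − 3(1+ε))` whenever `3(1+ε) < N`: canonical lifts (`CanonicalTowerLift`: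
`(∏ xᵢ)^N ≤ rad(a)^N · a`) give `∏ xᵢyᵢzᵢ ≤ rad(abc) · c^{3/N} ≤ M_S(abc) · c^{3/N}`, and
`c < C · (M_S · c^{3/N})^{1+ε}` rearranges; the constant is `C^(N/(N − 3(1+ε)))`.
Registered form: verbatim the skeleton's `stub_placesToLevel`. [cite: Vojta2000ABC, §3] -/
theorem stub_placesToLevel (N : ℕ)
    (hT : ∀ ε : ℝ, 0 < ε → ∃ C : ℝ, 0 < C ∧ ∀ x y z : Fin N → ℕ, (∀ i, 0 < x i ∧ 0 < y i ∧ 0 < z i) →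
      (∏ i, x i ^ (i.val + 1)) + (∏ i, y i ^ (i.val + 1)) = ∏ i, z i ^ (i.val + 1) →
      Nat.Coprime (∏ i, x i ^ (i.val + 1)) (∏ i, y i ^ (i.val + 1)) →
      ((∏ i, z i ^ (i.val + 1) : ℕ) : ℝ) < C * ((∏ i, x i * y i * z i : ℕ) : ℝ) ^ (1 + ε)) :
    ∀ ε : ℝ, 0 < ε → 3 * (1 + ε) < (N : ℝ) → ∃ C : ℝ, 0 < C ∧ ∀ S : Finset ℕ, (∀ p ∈ S, Nat.Prime p) →
      ∀ a b c : ℕ, IsABCTriple a b c →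
        (c : ℝ) < C * ((((∏ p ∈ S, p) *
          ∏ p ∈ (a * b * c).primeFactors \ S, p ^ (((a * b * c).factorization p + 3) / 4) : ℕ) : ℝ)) ^
            ((1 + ε) * N / (N - 3 * (1 + ε))) := by
  intro ε hε hN
  obtain ⟨C, hC, hTC⟩ := hT ε hε
  have hN1 : 1 ≤ N := by
    have h : (1 : ℝ) ≤ N := by linarith
    exact_mod_cast h
  -- Vojta's canonical lift, by name
  have hL : ∀ n : ℕ, 1 ≤ n → ∀ a : ℕ, 1 ≤ a → ∃ x : Fin n → ℕ, (∀ i, 0 < x i) ∧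
      (∏ i, x i ^ (i.val + 1)) = a ∧ (∏ i, x i) ^ n ≤ (radical a) ^ n * a :=
    canonicalTowerLift_proof
  refine ⟨C ^ ((N : ℝ) / (N - 3 * (1 + ε))), Real.rpow_pos_of_pos hC _, ?_⟩
  intro S hS a b c habc
  obtain ⟨ha, hb, hsum, hcop⟩ := habc
  have hc : 0 < c := by omega
  obtain ⟨x, hx0, hxa, hxle⟩ := hL N hN1 a ha
  obtain ⟨y, hy0, hyb, hyle⟩ := hL N hN1 b hb
  obtain ⟨z, hz0, hzc, hzle⟩ := hL N hN1 c hc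
  -- the hypothesis at the lifted point `(x, y, z)`
  have hmain := hTC x y z (fun i => ⟨hx0 i, hy0 i, hz0 i⟩) (by rw [hxa, hyb, hzc]; exact hsum)
    (by rw [hxa, hyb]; exact hcop)
  rw [hzc] at hmain
  -- sizes in `ℕ`: `P^N ≤ rad(abc)^N · c³ ≤ M_S(abc)^N · c³`
  have hPpos : 0 < ∏ i, x i * y i * z i :=
    Finset.prod_pos fun i _ => Nat.mul_pos (Nat.mul_pos (hx0 i) (hy0 i)) (hz0 i)
  have hMpos := uniformInK_mixed_pos (a * b * c) S hS
  have hPN : (∏ i, x i * y i * z i) ^ N ≤ ((∏ p ∈ S, p) *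
      ∏ p ∈ (a * b * c).primeFactors \ S, p ^ (((a * b * c).factorization p + 3) / 4)) ^ N *
        c ^ 3 :=
    (placesToLevel_lift_bound ⟨ha, hb, hsum, hcop⟩ hxle hyle hzle).trans
      (Nat.mul_le_mul_right _ (Nat.pow_le_pow_left (uniformInK_rad_le_mixed a b c S hS) N))
  exact placesToLevel_exp_step hC hε hN hc hPpos hMpos hmain hPN

end Summit.ABC.ABC.Theorems.UniformSadicTowerFour.MixedRadical
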